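import Literature.AlgebraicGeometry.Resolution.InseparableLocalUniformizationCurvesStepOne
import Literature.AlgebraicGeometry.Resolution.GeneralizedStabilityRankOneVT
import Literature.AlgebraicGeometry.Resolution.KnafKuhlmann2009Thm11
import Literature.FieldTheory.Separability.FormallySmoothSeparablyGenerated
import Literature.AlgebraicGeometry.Resolution.NormalizationFractions
import HarnessLib

/-!
# Temkin's Thm. 3.3.1 (smooth-fibre case): the hypotheses in the ambient valued field

Topic: `Literature/AlgebraicGeometry/Resolution` (valued function fields). Plumbing for the
assembly of M. Temkin, *Inseparable local uniformization*, J. Algebra 373 (2013) 65–119 =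
arXiv:0804.1554v3, Thm. 3.3.1 (tree: the named fact `Temkin2013RelativeCurveSmoothFibre`,
`InseparableLocalUniformizationCurvesStepOne.lean`). The fact is TYPED — a tower of fields
`k → K → K₁` with valuation rings `k° = K° ∩ k`, `K°`, `K₁° ⊇ K°` and hypotheses on `(K, K°)`
over `k` (equal characteristic, height one, finite generation, transcendence degree one,
`|K^×|/|k^×|` torsion, `K̃/k̃` algebraic) — whereas both halves of its algebraic proof live in
ONE algebraically closed valued field `(Ω, V)` containing `K₁`, with SUBFIELDS `k ≤ K ≤ K₁ ≤ Ω`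
and the vocabulary of `ValuedFunctionFields.lean` (`FGOver`, `IsValueTorsionOver`,
`IsResiduallyAlgebraicOver`, `IsRankOneValued`, …): the valuation-theoretic input (the
companion files `DeeplyRamified*.lean`, `Kuhlmann2019*.lean`, `RelativeCurveConstantsCharZero.lean`)
and the étale charts (`RelativeCurveChartSetup.lean`, `EChart.lean`, `RoofInField.lean`). This
file transports the hypotheses of the fact into that rendering, for any valued field
`(Ω, V) ⊇ (K₁, K₁°)` (e.g. `Ω = \overline{K₁}` with a Chevalley extension `V` of `K₁°`,
`exists_valuationSubring_comap_eq`):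

* `isValueTorsionOver_map`, `isResiduallyAlgebraicOver_map` — the two predicates pass along an
  embedding of valued fields `(K, V ∩ K) ↪ (Ω, V)` (images of subfields) — PROVED;
* `isValueTorsionOver_fieldRange_of_finiteDimensional`,
  `isResiduallyAlgebraicOver_fieldRange_of_finiteDimensional` — **`|K₁^×|/|k^×|` is torsion and
  `K̃₁/k̃` is algebraic** for the finite extension `K₁ ⊇ K`, inside `Ω` — PROVED;
* `fgOver_fieldRange` — **`K₁` is finitely generated over `k` inside `Ω`** — PROVED;
* `isRankOneValued_fieldRange_of_ringKrullDim_eq_one` — **height one ⇒ rank one** (`IsRankOneValued`,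
  the archimedean rendering, `isRankOneValued_of_overrings`), with
  `valuationSubring_ne_top_of_ringKrullDim_eq_one` and the passage to the finite extension
  `isRankOneValued_fieldRange_of_finiteDimensional` — PROVED;
* `ringExpChar_residueField_eq_of_equichar` — equal (exponential) characteristic of `(Ω, V)` from that of
  `(k, V ∩ k)` (`ringChar_residueField_eq_of_comap_eq`) — PROVED;
* `exists_transcendental_forall_isAlgebraic_fieldRange` — **transcendence degree one**: an
  element `t` of the image of `K₁`, transcendental over the image of `k`, with `K₁` algebraic over
  `k(t)` — PROVED;
* `separablyGeneratedOver_fieldRange_of_formallySmooth` — **separable generation of the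
  function field from the smoothness of the generic fibre** (`SeparablyGeneratedOver`; through
  Matsumura's Thm. 26.9, `Literature/FieldTheory/Separability/FormallySmoothSeparablyGenerated.lean`)
  for a field generated by a formally smooth finitely generated `k`-subalgebra — PROVED;
* `smoothFibre_ambient_hypotheses` — **all at once**, from exactly the hypotheses of
  `Temkin2013RelativeCurveSmoothFibre` and any `(Ω, V) ⊇ (K₁, K₁°)` — PROVED.

All statements are [folklore] bookkeeping; no definitions, no named facts.

## Sources

* M. Temkin, arXiv:0804.1554v3, §3.3, Thm. 3.3.1 (the hypotheses being transported).
-/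

noncomputable section

open IsLocalRing

namespace Literature.AlgebraicGeometry.Resolution

universe u

/-! ### Transport along an embedding of valued fields -/

section Transport

variable {K Ω : Type u} [Field K] [Field Ω] [Algebra K Ω] (V : ValuationSubring Ω)

/-- **Value-torsion passes along an embedding of valued fields**: if `|F^×|/|k^×|` is torsion
for subfields `k, F ⊆ K` and the valuation `V ∩ K`, then so is it for their images in
`(Ω, V)`. [folklore] -/
theorem isValueTorsionOver_map (k F : Subfield K)
    (h : IsValueTorsionOver (V.comap (algebraMap K Ω)) k F) :
    IsValueTorsionOver V (k.map (algebraMap K Ω)) (F.map (algebraMap K Ω)) := by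
  intro a ha ha0
  obtain ⟨a₀, ha₀, rfl⟩ := Subfield.mem_map.mp ha
  have ha₀0 : a₀ ≠ 0 := fun h0 => ha0 (by rw [h0, map_zero])
  obtain ⟨n, hn, b₀, hb₀, hval⟩ := h a₀ ha₀ ha₀0
  refine ⟨n, hn, algebraMap K Ω b₀, Subfield.mem_map.mpr ⟨b₀, hb₀, rfl⟩, ?_⟩
  rw [← map_pow]
  exact valuation_map_eq_of_comap V hval

/-- **Residual algebraicity passes along an embedding of valued fields.** [folklore] -/
theorem isResiduallyAlgebraicOver_map (k F : Subfield K)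
    (h : IsResiduallyAlgebraicOver (V.comap (algebraMap K Ω)) k F) :
    IsResiduallyAlgebraicOver V (k.map (algebraMap K Ω)) (F.map (algebraMap K Ω)) := by
  set O := V.comap (algebraMap K Ω) with hOdef
  intro r hr
  obtain ⟨a, ha, rfl⟩ := (mem_resField_iff _ _ _).mp hr
  obtain ⟨a₀, ha₀F, ha₀⟩ := Subfield.mem_map.mp ha
  have ha₀O : a₀ ∈ O := by
    rw [hOdef, ValuationSubring.mem_comap, ha₀]
    exact a.2
  let ψ : ResidueField O →+* ResidueField V := ResidueField.map (comapInclusion (F := K) V)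
  -- `ψ` maps the residue field of `k` into that of its image
  have hψ : ∀ t : resField O k, ψ t ∈ resField V (k.map (algebraMap K Ω)) := by
    rintro ⟨t, ht⟩
    obtain ⟨c, hck, rfl⟩ := (mem_resField_iff _ _ _).mp ht
    show ResidueField.map (comapInclusion V) (residue O c) ∈ _
    rw [ResidueField.map_residue]
    exact residue_mem_resField V _ (Subfield.mem_map.mpr ⟨(c : K), hck, rfl⟩)
  let f : resField O k →+* resField V (k.map (algebraMap K Ω)) :=
    (ψ.comp (resField O k).subtype).codRestrict _ hψ
  have halg : IsAlgebraic (resField O k) (residue O ⟨a₀, ha₀O⟩) :=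
    h _ (residue_mem_resField O ⟨a₀, ha₀O⟩ ha₀F)
  have halg' : IsAlgebraic (resField V (k.map (algebraMap K Ω))) (ψ (residue O ⟨a₀, ha₀O⟩)) :=
    halg.ringHom_of_comp_eq f ψ f.injective (by ext; rfl)
  have heq : residue V a = ψ (residue O ⟨a₀, ha₀O⟩) := by
    show _ = ResidueField.map (comapInclusion V) (residue O ⟨a₀, ha₀O⟩)
    rw [ResidueField.map_residue]
    congr 1
    exact Subtype.ext ha₀.symm
  rw [heq]
  exact halg'

end Transport

/-! ### The finite extension `K₁ ⊇ K` and the tower inside `Ω` -/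

section Tower

variable {k K K₁ Ω : Type u} [Field k] [Field K] [Field K₁] [Field Ω]
  [Algebra k K] [Algebra K K₁] [Algebra k K₁] [IsScalarTower k K K₁]
  [Algebra K₁ Ω] [Algebra K Ω] [Algebra k Ω] [IsScalarTower K K₁ Ω] [IsScalarTower k K₁ Ω]
  (V : ValuationSubring Ω)

omit [Algebra K₁ Ω] [Algebra K Ω] [Algebra k Ω] [IsScalarTower K K₁ Ω] [IsScalarTower k K₁ Ω] in
/-- The image of `k` in `K₁` is the image of its image in `K`. [folklore] -/
theorem fieldRange_map_eq :
    ((algebraMap k K).fieldRange).map (algebraMap K K₁) = (algebraMap k K₁).fieldRange := by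
  ext x
  constructor
  · rintro ⟨y, ⟨c, rfl⟩, rfl⟩
    exact ⟨c, (IsScalarTower.algebraMap_apply k K K₁ c)⟩
  · rintro ⟨c, rfl⟩
    exact ⟨algebraMap k K c, ⟨c, rfl⟩, (IsScalarTower.algebraMap_apply k K K₁ c).symm⟩

omit [Algebra K Ω] [IsScalarTower K K₁ Ω] [Algebra k K] [Algebra K K₁] [IsScalarTower k K K₁] in
/-- The image of `k` in `Ω` is the image of its image in `K₁`. [folklore] -/
theorem fieldRange_map_eq' :
    ((algebraMap k K₁).fieldRange).map (algebraMap K₁ Ω) = (algebraMap k Ω).fieldRange := by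
  ext x
  constructor
  · rintro ⟨y, ⟨c, rfl⟩, rfl⟩
    exact ⟨c, (IsScalarTower.algebraMap_apply k K₁ Ω c)⟩
  · rintro ⟨c, rfl⟩
    exact ⟨algebraMap k K₁ c, ⟨c, rfl⟩, (IsScalarTower.algebraMap_apply k K₁ Ω c).symm⟩

omit [Algebra K Ω] [IsScalarTower K K₁ Ω] in
/-- **`|K₁^×|/|k^×|` is torsion inside `Ω`** when `|K^×|/|k^×|` is and `K₁ ⊇ K` is finite
(`V` any valuation ring of `Ω`, the predicates being taken for `V ∩ K` and `V`). [folklore] -/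
theorem isValueTorsionOver_fieldRange_of_finiteDimensional [FiniteDimensional K K₁]
    (h : IsValueTorsionOver ((V.comap (algebraMap K₁ Ω)).comap (algebraMap K K₁))
      (algebraMap k K).fieldRange ⊤) :
    IsValueTorsionOver V (algebraMap k Ω).fieldRange (algebraMap K₁ Ω).fieldRange := by
  set O₁ := V.comap (algebraMap K₁ Ω) with hO₁def
  -- inside `K₁`: `K₁/K` finite, `K/k` torsion
  have h1 : IsValueTorsionOver O₁ (algebraMap k K₁).fieldRange ⊤ := by
    have hK : IsValueTorsionOver O₁ ((algebraMap k K).fieldRange.map (algebraMap K K₁))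
        ((⊤ : Subfield K).map (algebraMap K K₁)) := isValueTorsionOver_map O₁ _ _ h
    rw [fieldRange_map_eq, ← RingHom.fieldRange_eq_map] at hK
    have hK₁ : IsValueTorsionOver O₁ (algebraMap K K₁).fieldRange ⊤ :=
      isValueTorsionOver_of_isAlgebraic O₁ fun x _ => by
        have hx : IsAlgebraic K x := Algebra.IsAlgebraic.isAlgebraic x
        exact hx.ringHom_of_comp_eq (algebraMap K K₁).rangeRestrictField (RingHom.id K₁)
          (algebraMap K K₁).rangeRestrictField_bijective.1 (by ext; rfl)
    exact hK.trans hK₁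
  have h2 := isValueTorsionOver_map V _ _ h1
  rwa [fieldRange_map_eq', ← RingHom.fieldRange_eq_map] at h2

omit [Algebra K Ω] [IsScalarTower K K₁ Ω] in
/-- **`K̃₁/k̃` is algebraic inside `Ω`** when `K̃/k̃` is and `K₁ ⊇ K` is finite. [folklore] -/
theorem isResiduallyAlgebraicOver_fieldRange_of_finiteDimensional [FiniteDimensional K K₁]
    (h : IsResiduallyAlgebraicOver ((V.comap (algebraMap K₁ Ω)).comap (algebraMap K K₁))
      (algebraMap k K).fieldRange ⊤) :
    IsResiduallyAlgebraicOver V (algebraMap k Ω).fieldRange (algebraMap K₁ Ω).fieldRange := by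
  set O₁ := V.comap (algebraMap K₁ Ω) with hO₁def
  have h1 : IsResiduallyAlgebraicOver O₁ (algebraMap k K₁).fieldRange ⊤ := by
    have hK : IsResiduallyAlgebraicOver O₁ ((algebraMap k K).fieldRange.map (algebraMap K K₁))
        ((⊤ : Subfield K).map (algebraMap K K₁)) := isResiduallyAlgebraicOver_map O₁ _ _ h
    rw [fieldRange_map_eq, ← RingHom.fieldRange_eq_map] at hK
    have hK₁ : IsResiduallyAlgebraicOver O₁ (algebraMap K K₁).fieldRange ⊤ :=
      isResiduallyAlgebraicOver_of_isAlgebraic O₁ fun x _ => by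
        have hx : IsAlgebraic K x := Algebra.IsAlgebraic.isAlgebraic x
        exact hx.ringHom_of_comp_eq (algebraMap K K₁).rangeRestrictField (RingHom.id K₁)
          (algebraMap K K₁).rangeRestrictField_bijective.1 (by ext; rfl)
    exact hK.trans (show (algebraMap k K₁).fieldRange ≤ (algebraMap K K₁).fieldRange from by
      rintro _ ⟨c, rfl⟩
      exact ⟨algebraMap k K c, (IsScalarTower.algebraMap_apply k K K₁ c).symm⟩) hK₁
  have h2 := isResiduallyAlgebraicOver_map V _ _ h1
  rwa [fieldRange_map_eq', ← RingHom.fieldRange_eq_map] at h2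

/-- **`K₁` is finitely generated over `k` inside `Ω`** (`FGOver`), when `K/k` is finitely
generated and `K₁ ⊇ K` is finite. [folklore] -/
theorem fgOver_fieldRange [FiniteDimensional K K₁] (hfg : (⊤ : IntermediateField k K).FG) :
    FGOver (algebraMap k Ω).fieldRange (algebraMap K₁ Ω).fieldRange := by
  classical
  haveI : IsScalarTower k K Ω := IsScalarTower.of_algebraMap_eq fun c => by
    rw [IsScalarTower.algebraMap_apply k K₁ Ω, IsScalarTower.algebraMap_apply k K K₁,
      ← IsScalarTower.algebraMap_apply K K₁ Ω]
  obtain ⟨gK, hgK⟩ := hfg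
  obtain ⟨g₁, hg₁⟩ := IntermediateField.fg_top K K₁
  set kΩ : Subfield Ω := (algebraMap k Ω).fieldRange with hkΩ
  set T : Finset Ω := gK.image (algebraMap K Ω) ∪ g₁.image (algebraMap K₁ Ω) with hT
  refine ⟨T, le_antisymm ?_ ?_⟩
  · refine Subfield.closure_le.mpr (Set.union_subset ?_ ?_)
    · rintro _ ⟨c, rfl⟩
      exact ⟨algebraMap k K₁ c, (IsScalarTower.algebraMap_apply k K₁ Ω c).symm⟩
    · intro t ht
      rcases Finset.mem_union.mp ht with ht | ht
      · obtain ⟨y, -, rfl⟩ := Finset.mem_image.mp ht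
        exact ⟨algebraMap K K₁ y, (IsScalarTower.algebraMap_apply K K₁ Ω y).symm⟩
      · obtain ⟨y, -, rfl⟩ := Finset.mem_image.mp ht
        exact ⟨y, rfl⟩
  · -- the image of `K` lies in `k(gK)`, that of `K₁` in `K(g₁)`
    set C : Subfield Ω := Subfield.closure ((kΩ : Set Ω) ∪ ↑T) with hC
    have hKC : ∀ y : K, algebraMap K Ω y ∈ C := by
      intro y
      have hy : y ∈ IntermediateField.adjoin k (gK : Set K) := by rw [hgK]; exact IntermediateField.mem_top
      have hy' : (IsScalarTower.toAlgHom k K Ω) y ∈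
          (IntermediateField.adjoin k (gK : Set K)).map (IsScalarTower.toAlgHom k K Ω) := ⟨y, hy, rfl⟩
      rw [IntermediateField.adjoin_map] at hy'
      have hle : (IntermediateField.adjoin k ((IsScalarTower.toAlgHom k K Ω) '' (gK : Set K))).toSubfield
          ≤ C := by
        change Subfield.closure (Set.range (algebraMap k Ω) ∪ _) ≤ C
        refine Subfield.closure_mono (Set.union_subset_union (fun x hx => hx) ?_)
        rintro _ ⟨g, hg, rfl⟩
        exact Finset.mem_coe.mpr (Finset.mem_union_left _ (Finset.mem_image.mpr ⟨g, hg, rfl⟩))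
      exact hle hy'
    have hK₁C : ∀ y : K₁, algebraMap K₁ Ω y ∈ C := by
      intro y
      have hy : y ∈ IntermediateField.adjoin K (g₁ : Set K₁) := by rw [hg₁]; exact IntermediateField.mem_top
      have hy' : (IsScalarTower.toAlgHom K K₁ Ω) y ∈
          (IntermediateField.adjoin K (g₁ : Set K₁)).map (IsScalarTower.toAlgHom K K₁ Ω) := ⟨y, hy, rfl⟩
      rw [IntermediateField.adjoin_map] at hy'
      have hle : (IntermediateField.adjoin K ((IsScalarTower.toAlgHom K K₁ Ω) '' (g₁ : Set K₁))).toSubfield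
          ≤ C := by
        change Subfield.closure (Set.range (algebraMap K Ω) ∪ _) ≤ C
        refine Subfield.closure_le.mpr (Set.union_subset ?_ ?_)
        · rintro _ ⟨y, rfl⟩
          exact hKC y
        · rintro _ ⟨g, hg, rfl⟩
          exact Subfield.subset_closure (Or.inr (Finset.mem_coe.mpr
            (Finset.mem_union_right _ (Finset.mem_image.mpr ⟨g, hg, rfl⟩))))
      exact hle hy'
    rintro _ ⟨y, rfl⟩
    exact hK₁C y

/-- **Rank one passes from `K` to the finite extension `K₁`** inside `(Ω, V)`. [folklore] -/
theorem isRankOneValued_fieldRange_of_finiteDimensional [FiniteDimensional K K₁]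
    (hK : IsRankOneValued V (algebraMap K Ω).fieldRange) :
    IsRankOneValued V (algebraMap K₁ Ω).fieldRange := by
  have hle : (algebraMap K Ω).fieldRange ≤ (algebraMap K₁ Ω).fieldRange := by
    rintro _ ⟨y, rfl⟩
    exact ⟨algebraMap K K₁ y, (IsScalarTower.algebraMap_apply K K₁ Ω y).symm⟩
  let eK : K →+* (algebraMap K Ω).fieldRange := (algebraMap K Ω).rangeRestrictField
  have heK : (algebraMap (algebraMap K Ω).fieldRange Ω).comp eK =
      (algebraMap K₁ Ω).comp (algebraMap K K₁) := by
    ext c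
    exact IsScalarTower.algebraMap_apply K K₁ Ω c
  refine IsRankOneValued.of_algebraic V hle hK fun z hz => ?_
  obtain ⟨y, rfl⟩ := RingHom.mem_fieldRange.mp hz
  have hy : IsAlgebraic K y := Algebra.IsAlgebraic.isAlgebraic y
  exact hy.ringHom_of_comp_eq eK (algebraMap K₁ Ω) (algebraMap K Ω).rangeRestrictField_bijective.1 heK

end Tower

/-! ### Height one ⇒ rank one -/

section RankOne

variable {k Ω : Type u} [Field k] [Field Ω] [Algebra k Ω] (V : ValuationSubring Ω)

omit [Algebra k Ω] in
/-- A valuation ring of Krull dimension `1` is not the whole field (which has dimension `0`).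
[folklore] -/
theorem valuationSubring_ne_top_of_ringKrullDim_eq_one (O : ValuationSubring k)
    (hdim : ringKrullDim O = 1) : O ≠ ⊤ := by
  rintro rfl
  haveI : Ring.KrullDimLE 0 (⊤ : ValuationSubring k) := by
    refine Ring.KrullDimLE.mk₀ fun I hI => ?_
    rw [Ideal.isMaximal_iff]
    refine ⟨fun h1 => hI.ne_top ((Ideal.eq_top_iff_one I).mpr h1), fun J x hIJ hxI hxJ => ?_⟩
    have hx0 : (x : k) ≠ 0 := fun h0 => hxI (by
      have : x = 0 := Subtype.ext h0
      rw [this]; exact I.zero_mem)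
    have hunit : IsUnit x :=
      isUnit_of_inv_mem ⊤ x.2 (ValuationSubring.mem_top _) hx0
    exact J.eq_top_of_isUnit_mem hxJ hunit ▸ Submodule.mem_top
  have h0 : ringKrullDim (⊤ : ValuationSubring k) ≤ (0 : ℕ) := Ring.krullDimLE_iff.mp ‹_›
  rw [hdim] at h0
  exact absurd h0 (by norm_num)

/-- **Height one ⇒ rank one**: if `V ∩ k` has Krull dimension `1`, the image of `k` in
`(Ω, V)` is a rank-one valued subfield (`IsRankOneValued`: some element has value `> 1`, and
the values of `k` are archimedean with respect to every such element), through
`isRankOneValued_of_overrings` (the only overrings of a valuation ring of dimension `1` are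
itself and the field). [folklore] -/
theorem isRankOneValued_fieldRange_of_ringKrullDim_eq_one
    (hdim : ringKrullDim (V.comap (algebraMap k Ω)) = 1) :
    IsRankOneValued V (algebraMap k Ω).fieldRange := by
  set Ok := V.comap (algebraMap k Ω) with hOkdef
  set kΩ : Subfield Ω := (algebraMap k Ω).fieldRange with hkΩdef
  let e : k →+* kΩ := (algebraMap k Ω).rangeRestrictField
  have hebij : Function.Bijective e := (algebraMap k Ω).rangeRestrictField_bijective
  have hmem : ∀ c : k, e c ∈ V.comap (algebraMap kΩ Ω) ↔ c ∈ Ok := fun _ => Iff.rfl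
  haveI : Ring.KrullDimLE 1 Ok := (Ring.krullDimLE_iff (R := Ok)).mpr (le_of_eq hdim)
  have hOk_ne : Ok ≠ ⊤ := valuationSubring_ne_top_of_ringKrullDim_eq_one Ok hdim
  refine isRankOneValued_of_overrings V kΩ ?_ ?_
  · intro htop
    apply hOk_ne
    refine eq_top_iff.mpr fun c _ => ?_
    rw [← hmem, htop]
    exact ValuationSubring.mem_top _
  · intro S hS
    have hle : Ok ≤ S.comap e := fun c hc => by
      rw [ValuationSubring.mem_comap]
      exact hS ((hmem c).mpr hc)
    rcases ValuationSubring.eq_self_or_eq_top_of_le hle with h | h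
    · left
      ext x
      obtain ⟨c, rfl⟩ := hebij.2 x
      rw [hmem c, h, ValuationSubring.mem_comap]
    · right
      refine eq_top_iff.mpr fun x _ => ?_
      obtain ⟨c, rfl⟩ := hebij.2 x
      have : c ∈ S.comap e := by rw [h]; exact ValuationSubring.mem_top _
      exact this

end RankOne

/-! ### Equal characteristic -/

section Char

variable {k Ω : Type u} [Field k] [Field Ω] [Algebra k Ω] (V : ValuationSubring Ω)

/-- **Equal characteristic passes to `(Ω, V)`**: if `V ∩ k = k°` has residue field of the
characteristic of `k`, then the residue field of `V` has the characteristic of `Ω` (restatement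
of `ringChar_residueField_eq_of_comap_eq`), and likewise for the exponential characteristics.
[folklore] -/
theorem ringExpChar_residueField_eq_of_equichar
    (hchar : ringChar (ResidueField (V.comap (algebraMap k Ω))) = ringChar k) :
    ringExpChar (ResidueField V) = ringExpChar Ω := by
  rw [ringExpChar, ringExpChar, ringChar_residueField_eq_of_comap_eq V rfl hchar]

end Char

/-! ### Transcendence degree one -/

section Trdeg

variable {k K K₁ Ω : Type u} [Field k] [Field K] [Field K₁] [Field Ω]
  [Algebra k K] [Algebra K K₁] [Algebra k K₁] [IsScalarTower k K K₁]
  [Algebra K₁ Ω] [Algebra k Ω] [IsScalarTower k K₁ Ω]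

/-- Adjoining to the image of `k` in `Ω` is adjoining to `k`. [folklore] -/
theorem mem_adjoin_fieldRange_iff (S : Set Ω) (z : Ω) :
    z ∈ IntermediateField.adjoin (algebraMap k Ω).fieldRange S ↔
      z ∈ IntermediateField.adjoin k S := by
  rw [← IntermediateField.mem_toSubfield, ← IntermediateField.mem_toSubfield,
    IntermediateField.adjoin_toSubfield, IntermediateField.adjoin_toSubfield]
  have hr : Set.range (algebraMap ((algebraMap k Ω).fieldRange) Ω) = Set.range (algebraMap k Ω) := by
    ext y
    constructor
    · rintro ⟨⟨y, ⟨c, rfl⟩⟩, rfl⟩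
      exact ⟨c, rfl⟩
    · rintro ⟨c, rfl⟩
      exact ⟨⟨algebraMap k Ω c, ⟨c, rfl⟩⟩, rfl⟩
  rw [hr]

/-- **Transcendence degree one, inside `Ω`**: if `trdeg(K/k) = 1` and `K₁ ⊇ K` is finite, there is
`t` in the image of `K₁` (indeed of `K`), transcendental over the image of `k`, over which every
element of the image of `K₁` is algebraic (over `k(t)`). [folklore] -/
theorem exists_transcendental_forall_isAlgebraic_fieldRange [FiniteDimensional K K₁]
    (htr : Algebra.trdeg k K = 1) :
    ∃ t ∈ (algebraMap K₁ Ω).fieldRange, Transcendental (algebraMap k Ω).fieldRange t ∧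
      ∀ z ∈ (algebraMap K₁ Ω).fieldRange,
        IsAlgebraic (IntermediateField.adjoin (algebraMap k Ω).fieldRange ({t} : Set Ω)) z := by
  classical
  -- a transcendence basis of `K/k` has one element `x₀`
  obtain ⟨s, hs⟩ := exists_isTranscendenceBasis k K
  have hcard : Cardinal.mk s = 1 := by rw [hs.cardinalMk_eq_trdeg, htr]
  obtain ⟨x₀, hsx₀⟩ := Cardinal.mk_set_eq_one_iff.mp hcard
  have hrange : Set.range ((↑) : s → K) = {x₀} := by rw [Subtype.range_coe, hsx₀]
  haveI halgK : Algebra.IsAlgebraic (IntermediateField.adjoin k ({x₀} : Set K)) K := by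
    have h := hs.isAlgebraic_field
    rwa [hrange] at h
  have hx₀tr : Transcendental k x₀ := by
    have h := hs.1.transcendental ⟨x₀, by rw [hsx₀]; exact Set.mem_singleton x₀⟩
    exact h
  -- the images
  set kΩ : Subfield Ω := (algebraMap k Ω).fieldRange with hkΩ
  let e : k →+* kΩ := (algebraMap k Ω).rangeRestrictField
  have hebij : Function.Bijective e := (algebraMap k Ω).rangeRestrictField_bijective
  let φ : K →+* Ω := (algebraMap K₁ Ω).comp (algebraMap K K₁)
  have hφ : (algebraMap kΩ Ω).comp e = φ.comp (algebraMap k K) := by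
    ext c
    change algebraMap k Ω c = algebraMap K₁ Ω (algebraMap K K₁ (algebraMap k K c))
    rw [← IsScalarTower.algebraMap_apply k K K₁, ← IsScalarTower.algebraMap_apply k K₁ Ω]
  set t : Ω := φ x₀ with ht
  refine ⟨t, ⟨algebraMap K K₁ x₀, rfl⟩, ?_, ?_⟩
  · exact hx₀tr.ringHom_of_comp_eq e φ hebij.2 φ.injective hφ
  · rintro _ ⟨y, rfl⟩
    -- `y` is algebraic over `k(x₀)`
    set k₀ : IntermediateField k K := IntermediateField.adjoin k ({x₀} : Set K) with hk₀
    haveI : Algebra.IsAlgebraic k₀ K₁ := Algebra.IsAlgebraic.trans k₀ K K₁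
    have hy : IsAlgebraic k₀ y := Algebra.IsAlgebraic.isAlgebraic y
    -- the restriction `k₀ → kΩ(t)` of `φ`
    let φₐ : K →ₐ[k] Ω := (IsScalarTower.toAlgHom k K₁ Ω).comp (IsScalarTower.toAlgHom k K K₁)
    have hφₐ : ∀ w : K, φₐ w = φ w := fun _ => rfl
    have hmem : ∀ w : k₀, φ (w : K) ∈
        IntermediateField.adjoin (algebraMap k Ω).fieldRange ({t} : Set Ω) := by
      intro w
      rw [mem_adjoin_fieldRange_iff, ← hφₐ]
      have hw : φₐ (w : K) ∈ (IntermediateField.adjoin k ({x₀} : Set K)).map φₐ :=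
        ⟨(w : K), w.2, rfl⟩
      rw [IntermediateField.adjoin_map, Set.image_singleton] at hw
      exact hw
    let f : k₀ →+* IntermediateField.adjoin (algebraMap k Ω).fieldRange ({t} : Set Ω) :=
      (φ.comp (algebraMap k₀ K)).codRestrict _ hmem
    have hfinj : Function.Injective f := by
      intro a b hab
      have h1 : φ (a : K) = φ (b : K) := congrArg Subtype.val hab
      exact Subtype.ext (φ.injective h1)
    have hcomp : (algebraMap (IntermediateField.adjoin (algebraMap k Ω).fieldRange ({t} : Set Ω)) Ω).comp f
        = (algebraMap K₁ Ω).comp (algebraMap k₀ K₁) := RingHom.ext fun _ => rfl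
    exact hy.ringHom_of_comp_eq f (algebraMap K₁ Ω) hfinj hcomp

end Trdeg

/-! ### Separable generation from the smoothness of the generic fibre -/

section Separable

variable {k F Ω : Type u} [Field k] [Field F] [Field Ω] [Algebra k F] [Algebra F Ω] [Algebra k Ω]
  [IsScalarTower k F Ω]

omit [Algebra F Ω] [Algebra k Ω] [IsScalarTower k F Ω] in
/-- A `k`-subalgebra of `F` of which every element of `F` is a quotient presents `F` as its
field of fractions. [folklore] -/
theorem isFractionRing_subalgebra_of_forall_exists_div (B : Subalgebra k F)
    (h : ∀ z : F, ∃ a ∈ B, ∃ b ∈ B, z = a / b) : IsFractionRing B F := by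
  refine ⟨?_, fun z => ?_, fun {x y} hxy => ⟨1, ?_⟩⟩
  · rintro ⟨y, hy⟩
    have hy0 : (y : F) ≠ 0 := fun h0 => nonZeroDivisors.ne_zero hy (Subtype.ext h0)
    exact isUnit_iff_ne_zero.mpr hy0
  · obtain ⟨a, ha, b, hb, rfl⟩ := h z
    by_cases hb0 : b = 0
    · exact ⟨(0, 1), by simp [hb0]⟩
    · refine ⟨(⟨a, ha⟩, ⟨⟨b, hb⟩, mem_nonZeroDivisors_of_ne_zero fun h0 => hb0 ?_⟩), ?_⟩
      · exact congrArg Subtype.val h0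
      · change a / b * b = a
        rw [div_mul_cancel₀ a hb0]
  · have : x = y := Subtype.ext hxy
    rw [this]

/-- **A field generated by a formally smooth finitely generated `k`-subalgebra is separably
generated over `k`, inside `Ω`** (`SeparablyGeneratedOver` of the images): Matsumura's
Thm. 26.9 (`exists_isTranscendenceBasis_and_isSeparable_of_isFractionRing`) transported into
the ambient field. [folklore] -/
theorem separablyGeneratedOver_fieldRange_of_formallySmooth (B : Subalgebra k F)
    (hfr : ∀ z : F, ∃ a ∈ B, ∃ b ∈ B, z = a / b) [Algebra.FiniteType k B]
    [Algebra.FormallySmooth k B] :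
    SeparablyGeneratedOver (algebraMap k Ω).fieldRange (algebraMap F Ω).fieldRange := by
  classical
  haveI : IsFractionRing B F := isFractionRing_subalgebra_of_forall_exists_div B hfr
  obtain ⟨s, hs, hsep⟩ :=
    Literature.FieldTheory.Separability.exists_isTranscendenceBasis_and_isSeparable_of_isFractionRing
      k F B
  set kΩ : Subfield Ω := (algebraMap k Ω).fieldRange with hkΩ
  let e : k →+* kΩ := (algebraMap k Ω).rangeRestrictField
  have hebij : Function.Bijective e := (algebraMap k Ω).rangeRestrictField_bijective
  let φ : F →+* Ω := algebraMap F Ω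
  have hφ : (algebraMap kΩ Ω).comp e = φ.comp (algebraMap k F) := by
    ext c
    exact IsScalarTower.algebraMap_apply k F Ω c
  refine ⟨s.image φ, ?_, ?_, ?_⟩
  · intro t ht
    obtain ⟨y, -, rfl⟩ := Finset.mem_image.mp (Finset.mem_coe.mp ht)
    exact ⟨y, rfl⟩
  · -- algebraic independence of the image basis over `kΩ`
    have h1 : AlgebraicIndependent kΩ (φ ∘ ((↑) : s → F)) :=
      hs.1.ringHom_of_comp_eq e φ hebij.2 φ.injective hφ
    have h2 : AlgebraicIndependent kΩ ((↑) : (φ '' (s : Set F)) → Ω) :=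
      (algebraicIndependent_image φ.injective.injOn).mp h1
    convert h2 using 2 <;> simp
  · -- separability over `kΩ(φ s)`
    rintro _ ⟨y, rfl⟩
    set k₀ : IntermediateField k F := IntermediateField.adjoin k (s : Set F) with hk₀
    have hy : IsSeparable k₀ y := Algebra.IsSeparable.isSeparable k₀ y
    -- move `y` into `Ω` over `k₀`
    have hy' : IsSeparable k₀ (φ y) :=
      (isSeparable_map_iff (IsScalarTower.toAlgHom k₀ F Ω) φ.injective).mpr hy
    -- change the base to `kΩ(φ s)`
    let φₐ : F →ₐ[k] Ω := IsScalarTower.toAlgHom k F Ω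
    have hφₐ : ∀ w : F, φₐ w = φ w := fun _ => rfl
    have hmem : ∀ w : k₀, φ (w : F) ∈
        IntermediateField.adjoin kΩ ((s.image φ : Finset Ω) : Set Ω) := by
      intro w
      rw [hkΩ, mem_adjoin_fieldRange_iff, ← hφₐ, Finset.coe_image]
      have hw : φₐ (w : F) ∈ (IntermediateField.adjoin k (s : Set F)).map φₐ :=
        ⟨(w : F), w.2, rfl⟩
      rw [IntermediateField.adjoin_map] at hw
      exact hw
    let f : k₀ →+* IntermediateField.adjoin kΩ ((s.image φ : Finset Ω) : Set Ω) :=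
      (φ.comp (algebraMap k₀ F)).codRestrict _ hmem
    have hcomp : (algebraMap (IntermediateField.adjoin kΩ ((s.image φ : Finset Ω) : Set Ω)) Ω).comp f
        = algebraMap k₀ Ω := RingHom.ext fun _ => rfl
    exact isSeparable_of_ringHom_comp_eq f hcomp hy'

end Separable


/-! ### All at once: the hypotheses of the smooth-fibre case of Thm. 3.3.1 inside `(Ω, V)` -/

section Bundle

/-- **The hypotheses of `Temkin2013RelativeCurveSmoothFibre` in the ambient rendering.** Given the
data and hypotheses of the fact (Thm. 3.3.1 for `n = 1` and `k`-smooth generic fibre of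
`C₁ = Nr_{K₁}(C)`) and ANY valued field `(Ω, V)` over `K₁` inducing `K₁°`, the images
`kΩ ≤ K₁Ω` of `k` and `K₁` satisfy: `K₁Ω|kΩ` is finitely generated, `|K₁^×|/|k^×|` is torsion,
`K̃₁/k̃` is algebraic, `(kΩ, V)` and `(K₁Ω, V)` have rank one, `K₁Ω|kΩ` is separably generated,
the residue field of `V` has the exponential characteristic of `Ω`, and some `t ∈ K₁Ω`
transcendental over `kΩ` has `K₁Ω` algebraic over `kΩ(t)`. [folklore] -/
theorem smoothFibre_ambient_hypotheses (k K : Type u) [Field k] [Field K] [Algebra k K]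
    (Ok : ValuationSubring k) (O : ValuationSubring K)
    (hchar : ringChar (ResidueField Ok) = ringChar k)
    (hOk : O.comap (algebraMap k K) = Ok) (hk1 : ringKrullDim Ok = 1) (hK1 : ringKrullDim O = 1)
    (hfg : (⊤ : IntermediateField k K).FG) (htr : Algebra.trdeg k K = 1)
    (hvt : IsValueTorsionOver O (algebraMap k K).fieldRange ⊤)
    (hra : IsResiduallyAlgebraicOver O (algebraMap k K).fieldRange ⊤)
    (A : Subring K) (hA : IsAffineNormalizedModel O (Ok.toSubring.map (algebraMap k K)) A)
    (K₁ : Type u) [Field K₁] [Algebra K K₁] [Algebra k K₁] [IsScalarTower k K K₁]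
    [FiniteDimensional K K₁] (O₁ : ValuationSubring K₁) (hO₁ : O₁.comap (algebraMap K K₁) = O)
    (hsm₁ : Algebra.Smooth k (Algebra.adjoin k (nrIn (A.map (algebraMap K K₁)) : Set K₁)))
    (Ω : Type u) [Field Ω] [Algebra K₁ Ω] [Algebra K Ω] [Algebra k Ω] [IsScalarTower K K₁ Ω]
    [IsScalarTower k K₁ Ω] (V : ValuationSubring Ω) (hV : V.comap (algebraMap K₁ Ω) = O₁) :
    (algebraMap k Ω).fieldRange ≤ (algebraMap K₁ Ω).fieldRange ∧
    FGOver (algebraMap k Ω).fieldRange (algebraMap K₁ Ω).fieldRange ∧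
    IsValueTorsionOver V (algebraMap k Ω).fieldRange (algebraMap K₁ Ω).fieldRange ∧
    IsResiduallyAlgebraicOver V (algebraMap k Ω).fieldRange (algebraMap K₁ Ω).fieldRange ∧
    IsRankOneValued V (algebraMap k Ω).fieldRange ∧
    IsRankOneValued V (algebraMap K₁ Ω).fieldRange ∧
    SeparablyGeneratedOver (algebraMap k Ω).fieldRange (algebraMap K₁ Ω).fieldRange ∧
    ringExpChar (ResidueField V) = ringExpChar Ω ∧
    ∃ t ∈ (algebraMap K₁ Ω).fieldRange, Transcendental (algebraMap k Ω).fieldRange t ∧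
      ∀ z ∈ (algebraMap K₁ Ω).fieldRange,
        IsAlgebraic (IntermediateField.adjoin (algebraMap k Ω).fieldRange ({t} : Set Ω)) z := by
  classical
  -- the valuation rings induced by `V`
  have hO : (V.comap (algebraMap K₁ Ω)).comap (algebraMap K K₁) = O := by rw [hV, hO₁]
  have hVk : V.comap (algebraMap k Ω) = Ok := by
    rw [← hOk, ← hO, ValuationSubring.comap_comap, ValuationSubring.comap_comap,
      ← IsScalarTower.algebraMap_eq k K K₁, ← IsScalarTower.algebraMap_eq k K₁ Ω]
  have hVK : V.comap (algebraMap K Ω) = O := by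
    rw [← hO, ValuationSubring.comap_comap, ← IsScalarTower.algebraMap_eq K K₁ Ω]
  rw [← hO] at hvt hra
  have hle : (algebraMap k Ω).fieldRange ≤ (algebraMap K₁ Ω).fieldRange := by
    rintro _ ⟨c, rfl⟩
    exact ⟨algebraMap k K₁ c, (IsScalarTower.algebraMap_apply k K₁ Ω c).symm⟩
  refine ⟨hle, fgOver_fieldRange hfg, isValueTorsionOver_fieldRange_of_finiteDimensional V hvt,
    isResiduallyAlgebraicOver_fieldRange_of_finiteDimensional V hra, ?_, ?_, ?_, ?_, ?_⟩
  · -- rank one of `k`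
    refine isRankOneValued_fieldRange_of_ringKrullDim_eq_one V ?_
    rw [hVk]
    exact hk1
  · -- rank one of `K₁`: `K` has height one and `K₁ ⊇ K` is algebraic
    have hK : IsRankOneValued V (algebraMap K Ω).fieldRange :=
      isRankOneValued_fieldRange_of_ringKrullDim_eq_one V (by rw [hVK]; exact hK1)
    exact isRankOneValued_fieldRange_of_finiteDimensional V hK
  · -- separable generation from the smooth generic fibre of `Nr_{K₁}(A)`
    obtain ⟨-, -, -, hfrA⟩ := hA
    have hfr : ∀ z : K₁, ∃ a ∈ Algebra.adjoin k (nrIn (A.map (algebraMap K K₁)) : Set K₁),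
        ∃ b ∈ Algebra.adjoin k (nrIn (A.map (algebraMap K K₁)) : Set K₁), z = a / b := fun z => by
      obtain ⟨a, ha, b, hb, -, h⟩ := exists_div_nrIn A hfrA z
      exact ⟨a, Algebra.subset_adjoin ha, b, Algebra.subset_adjoin hb, h⟩
    haveI := hsm₁.formallySmooth
    haveI := hsm₁.finitePresentation
    exact separablyGeneratedOver_fieldRange_of_formallySmooth _ hfr
  · -- equal characteristic
    refine ringExpChar_residueField_eq_of_equichar (k := k) V ?_
    rw [hVk]
    exact hchar
  · exact exists_transcendental_forall_isAlgebraic_fieldRange htr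

end Bundle

end Literature.AlgebraicGeometry.Resolution

end
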